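import Literature.NumberTheory.GaloisRepresentations.HasseNormEtaleInvolutionNormPairs
import Literature.NumberTheory.GaloisRepresentations.HasseNormEtaleInvolutionNormStable
import HarnessLib

/-!
# The descent step of the determinant reading: `∏_{𝔪 τ-stable} N_{K₀,𝔪/F}(W_𝔪)` is an idelic norm from `L`
# (Rogawski 1990 §3.5 Prop. 3.5.2; Cassels–Fröhlich II §19 (19.7), VII §7.3 (a))

Topic `NumberTheory/GaloisRepresentations`; namespace `Literature.NumberTheory.GaloisRepresentations`.  THEOREMS ONLY (no definition, no
instance, no notation, no named fact); universe `Type`.  Sixth sequel of ★ `HasseNormEtaleInvolution` — FILE H (the HEAD) of the row G6∕R6d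
«det-reading (Ⅱ)» of the floor-0 unitary stabilisation (engine T1, crux H413), after ★ (Ⅱa) `HasseNormEtaleInvolutionNorm`
(`det x_g = ∏_𝔪 N(θ_𝔪((1 ⊗ π_𝔪) X))`), ★ FILE P `HasseNormEtaleInvolutionNormPairs` (the swapped pairs `{𝔪, τ𝔪}` contribute `y · σ_𝔸 y`) and
FILE S `HasseNormEtaleInvolutionNormStable` (a `τ`-stable factor contributes `con(N_{K₀,𝔪/F} W_𝔪)` for the DESCENDED idele `W_𝔪 ∈ J_{K₀,𝔪}`,
`K₀,𝔪 = K_𝔪^τ`).  Setting: `F ⊂ L` quadratic with `Gal(L/F) = {1, σ}`, `σ_𝔸 = σ ⊗ 1` on `𝔸_L`; `γ ∈ M_N(L)` regular semisimple, `B = L[γ]`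
with a `σ`-semilinear `F`-involution `τ`; a `τ`-fixed adelic unit `X ∈ (𝔸_F ⊗_F B)ˣ` with `det (Ψ X) = σ_𝔸 D · D` (for the Cartan class
`x_g = Ψ X` of a rational element `g`, `det x_g = det g · σ(det g)`).

* §1 (N5) DESCENT FOR `L ∕ F` QUADRATIC: **`baseChange_adeleRelNorm_eq_apply_mul`** (`con_{L/F}(N_{L/F} Y) = σ_𝔸 Y · Y`: Cassels's norm (19.7)
  followed by the conorm is the Galois norm `∏_{g ∈ Gal} g • Y`, ★ `baseChange_adeleRelNorm_eq_prod_smul`, and `Gal(L/F) = {1, σ}`);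
  **`eq_ideleRelNorm_of_baseChange_eq_apply_mul`** (`con n = σ_𝔸 Y · Y ⇒ n = N_{L/F} Y` in `J_F`: the conorm `𝔸_F → 𝔸_L` is injective,
  [CasselsFrohlichANT1967, VII §7.3 (a)]).
* §2 **THE HEAD `exists_prod_ideleRelNorm_fixedField_eq`**: with the `τ`-stable factors presented as `π_i : B ↠ C_i` (`ker π_i = 𝔪_i`,
  `π_i ∘ τ = τ_{C_i} ∘ π_i`, indexed by `e : ι ≃ {𝔪 ∣ τ⁻¹𝔪 = 𝔪}` = the letters of ★ `Rogawski1990.cartanIndex`) and descended ideles `W_i ∈ J_{C_i^τ}`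
  (`con W_i = Z_{π_i}(X)`, ★ `HasseNormEtaleInvolutionDescent` (E1)): **`∃ Y ∈ J_L, ∏_i N_{C_i^τ/F}(W_i) = N_{L/F}(Y)`** — (N1) + (P) + (S) give
  `σ_𝔸 D · D = con(∏_i N W_i) · (y · σ_𝔸 y)`, all factors units, so `con(∏_i N W_i) = σ_𝔸 Y · Y` with `Y = D · y⁻¹`, and (N5) descends it.
  This is the «`det x = ∏ N_{K_i/L}(x_i)`, hence `∑ ε_i(x) = 0`» step of [Rogawski1990, Prop. 3.5.2] in idelic form; the consumer is
  `Rogawski1990/CartanObstruction` (`sum_cartanObsFun_eq_zero`: the obstruction vector lies in the sum-zero hyperplane `A(T)`).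

## References
* J. D. Rogawski, *Automorphic Representations of Unitary Groups in Three Variables*, Ann. of Math. Stud. 123 (1990), §3.5 Prop. 3.5.2
  [Rogawski1990].
* J. W. S. Cassels, A. Fröhlich (eds.), *Algebraic Number Theory* (1967), Ch. II (Cassels) §19 (19.7); Ch. VII (Tate) §7.1, §7.3 (a)
  [CasselsFrohlichANT1967].
-/

set_option autoImplicit false

noncomputable section

open scoped TensorProduct NumberField NumberField.AdeleRing

namespace Literature.NumberTheory.GaloisRepresentations

open NumberField IsDedekindDomain
open Literature.NumberTheory.AdelicBaseChange Literature.NumberTheory.Automorphic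

/-! ## §1 (N5) Descent of `σ_𝔸 Y · Y` to an idelic norm for `L ∕ F` quadratic -/

section Quadratic

variable {F L : Type} [Field F] [NumberField F] [Field L] [NumberField L] [Algebra F L]

/-- FLT's adelic base change `con_{L/F} : 𝔸_F → 𝔸_L` is injective (the tree's `AdeleRing.baseChange_injective` read through
★ `adeleRing_baseChange_apply_eq`). [cite: CasselsFrohlichANT1967, Ch. VII §7.3 (a)] -/
private theorem numberField_adeleRing_baseChange_injective :
    Function.Injective (NumberField.AdeleRing.baseChange F L) := by
  rw [show ⇑(NumberField.AdeleRing.baseChange F L) = ⇑(Literature.NumberTheory.Automorphic.AdeleRing.baseChange F L) from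
    funext (adeleRing_baseChange_apply_eq F L)]
  exact Literature.NumberTheory.Automorphic.AdeleRing.baseChange_injective F L

/-- **(N5a) `con_{L/F}(N_{L/F} Y) = σ_𝔸 Y · Y` for `L ∕ F` quadratic with `Gal(L/F) = {1, σ}`** (Cassels's norm (19.7) followed by the
conorm is the Galois norm `∏_g g • Y`, ★ `baseChange_adeleRelNorm_eq_prod_smul`, and the product has the two factors `Y`, `σ • Y`).
[cite: CasselsFrohlichANT1967, Ch. II §19 (19.7) with Ch. VII §7.1] -/
theorem baseChange_adeleRelNorm_eq_apply_mul [Algebra.IsQuadraticExtension F L] (σ : L ≃ₐ[F] L) (hσ1 : σ ≠ 1)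
    (σA : AdeleRing (𝓞 L) L →+* AdeleRing (𝓞 L) L) (hσA : ∀ z, σA z = σ • z) (Y : AdeleRing (𝓞 L) L) :
    NumberField.AdeleRing.baseChange F L (adeleRelNorm F L Y) = σA Y * Y := by
  classical
  have huniv : (Finset.univ : Finset (L ≃ₐ[F] L)) = {σ, 1} := by
    symm
    apply Finset.eq_univ_of_card
    rw [Finset.card_pair hσ1, ← Nat.card_eq_fintype_card, IsGalois.card_aut_eq_finrank,
      Algebra.IsQuadraticExtension.finrank_eq_two]
  rw [baseChange_adeleRelNorm_eq_prod_smul, huniv, Finset.prod_pair hσ1, one_smul, hσA]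

/-- **(N5b) descent to an idelic norm**: if `con_{L/F}(n) = σ_𝔸 Y · Y` for an idele `n` of `F` and an idele `Y` of `L` (`L ∕ F` quadratic,
`Gal = {1, σ}`), then `n = N_{L/F} Y` in `J_F` (injectivity of the conorm `𝔸_F → 𝔸_L`, [CasselsFrohlichANT1967, VII §7.3 (a)]).
[cite: CasselsFrohlichANT1967, Ch. II §19 (19.7); Ch. VII §7.3 (a)] -/
theorem eq_ideleRelNorm_of_baseChange_eq_apply_mul [Algebra.IsQuadraticExtension F L] (σ : L ≃ₐ[F] L) (hσ1 : σ ≠ 1)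
    (σA : AdeleRing (𝓞 L) L →+* AdeleRing (𝓞 L) L) (hσA : ∀ z, σA z = σ • z)
    (n : ideleGroup F) (Y : (AdeleRing (𝓞 L) L)ˣ)
    (h : NumberField.AdeleRing.baseChange F L (n : AdeleRing (𝓞 F) F) = σA ↑Y * ↑Y) :
    n = AdelicBaseChange.ideleRelNorm F L Y := by
  apply Units.ext
  rw [coe_ideleRelNorm]
  apply numberField_adeleRing_baseChange_injective (F := F) (L := L)
  rw [h, baseChange_adeleRelNorm_eq_apply_mul σ hσ1 σA hσA]

/-- (N5c) unit bookkeeping: in a commutative ring with an endomorphism `φ`, if `φ D · D` is a unit and `φ D · D = B₀ · (y · φ y)`, then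
`B₀ = φ Y · Y` for the UNIT `Y := D · y⁻¹` (`y` is a unit because `y · φ y` divides a unit). [folklore] -/
private theorem exists_units_apply_mul_eq {R : Type} [CommRing R] (φ : R →+* R) {D B₀ y : R} (hu : IsUnit (φ D * D))
    (h : φ D * D = B₀ * (y * φ y)) : ∃ Y : Rˣ, φ ↑Y * ↑Y = B₀ := by
  have hyφ : IsUnit (y * φ y) := isUnit_of_mul_isUnit_right (h ▸ hu)
  have hy : IsUnit y := isUnit_of_mul_isUnit_left hyφ
  have hDu : IsUnit D := isUnit_of_mul_isUnit_right hu
  refine ⟨hDu.unit * hy.unit⁻¹, ?_⟩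
  have h2 : y * ↑hy.unit⁻¹ = 1 := hy.mul_val_inv
  have h3 : φ y * φ ↑hy.unit⁻¹ = 1 := by rw [← map_mul, h2, map_one]
  rw [Units.val_mul, IsUnit.unit_spec, map_mul]
  linear_combination (φ ↑hy.unit⁻¹ * ↑hy.unit⁻¹) * h + B₀ * (φ y * φ ↑hy.unit⁻¹) * h2 + B₀ * h3

end Quadratic

/-! ## §2 THE HEAD: `∏_{i} N_{K₀ᵢ/F}(W_i) ∈ N_{L/F}(J_L)` -/

section Head

variable {F L : Type} [Field F] [NumberField F] [Field L] [NumberField L] [Algebra F L]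

/-- **THE HEAD of det-reading (Ⅱ) — `∏_{𝔪 τ-stable} N_{K₀,𝔪 ∕ F}(W_𝔪) = N_{L/F}(Y)` for some idele `Y` of `L`.**  For `γ ∈ M_N(L)` regular
semisimple, `B = L[γ]` with a `σ`-semilinear involution `τ`, a `τ`-fixed adelic unit `X ∈ (𝔸_F ⊗_F B)ˣ` whose image `x_g = Ψ X ∈ M_N(𝔸_L)`
has `det x_g = σ_𝔸 D · D`, and the `τ`-stable factors presented as `π_i : B ↠ C_i` (kernel `𝔪_i`, `π_i ∘ τ = τ_{C_i} ∘ π_i`) with DESCENDED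
ideles `W_i ∈ J_{K₀ᵢ}`, `K₀ᵢ = C_i^{τ}` (`con W_i = Z_{π_i}(X)`): the product of the norms `N_{K₀ᵢ/F} W_i` is a norm from `J_L`.  Assembly of
★ (N1) `det_eq_prod_norm_transfer` (`det x_g = ∏_𝔪 N(θ_𝔪 (1⊗π_𝔪) X)`), (P) the orbit split of the non-stable pairs `{𝔪, τ𝔪}` into
`y · σ_𝔸 y`, (S) the stable factors `N(…) = con(N_{K₀ᵢ/F} W_i)`, and (N5) `con ∘ N_{L/F} = (1 + σ)` with `con` injective — Rogawski's
«`det x = ∏ N_{K_i/L}(x_i)` … hence `∑ ε_i = 0`» step of Prop. 3.5.2, in idelic form.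
[cite: Rogawski1990, §3.5 Prop. 3.5.2] [cite: CasselsFrohlichANT1967, Ch. II §19 (19.7); Ch. VII §7.3 (a)] -/
theorem exists_prod_ideleRelNorm_fixedField_eq [Algebra.IsQuadraticExtension F L]
    (σ : L ≃ₐ[F] L) (hσ : σ * σ = 1) (hσ1 : σ ≠ 1)
    [Algebra F (AdeleRing (𝓞 L) L)] [IsScalarTower F L (AdeleRing (𝓞 L) L)]
    (σA : AdeleRing (𝓞 L) L →+* AdeleRing (𝓞 L) L) (hσA : ∀ z, σA z = σ • z)
    {N : ℕ} {γ : Matrix (Fin N) (Fin N) L} (hreg : γ.charpoly.Separable)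
    (τ : ↥(Algebra.adjoin L ({γ} : Set (Matrix (Fin N) (Fin N) L))) ≃ₐ[F] ↥(Algebra.adjoin L ({γ} : Set (Matrix (Fin N) (Fin N) L))))
    (hτ : ∀ b, τ (τ b) = b) (hτσ : ∀ (ℓ : L) (b : ↥(Algebra.adjoin L ({γ} : Set (Matrix (Fin N) (Fin N) L)))), τ (ℓ • b) = σ ℓ • τ b)
    (Ψ : AdeleRing (𝓞 F) F ⊗[F] ↥(Algebra.adjoin L ({γ} : Set (Matrix (Fin N) (Fin N) L))) →ₐ[F] Matrix (Fin N) (Fin N) (AdeleRing (𝓞 L) L))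
    (hΨ : ∀ (r : AdeleRing (𝓞 F) F) (b : ↥(Algebra.adjoin L ({γ} : Set (Matrix (Fin N) (Fin N) L)))),
      Ψ (r ⊗ₜ b) = NumberField.AdeleRing.baseChange F L r • (b : Matrix (Fin N) (Fin N) L).map (algebraMap L (AdeleRing (𝓞 L) L)))
    (X : (AdeleRing (𝓞 F) F ⊗[F] ↥(Algebra.adjoin L ({γ} : Set (Matrix (Fin N) (Fin N) L))))ˣ)
    (hX : Algebra.TensorProduct.map (AlgHom.id (AdeleRing (𝓞 F) F) (AdeleRing (𝓞 F) F))
      (τ : ↥(Algebra.adjoin L ({γ} : Set (Matrix (Fin N) (Fin N) L))) →ₐ[F] ↥(Algebra.adjoin L ({γ} : Set (Matrix (Fin N) (Fin N) L)))) ↑X = ↑X)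
    {D : AdeleRing (𝓞 L) L} (hD : (Ψ ↑X).det = σA D * D)
    {ι : Type} [Fintype ι]
    (e : ι ≃ {I : MaximalSpectrum ↥(Algebra.adjoin L ({γ} : Set (Matrix (Fin N) (Fin N) L))) // I.asIdeal.comap τ = I.asIdeal})
    (C : ι → Type) [∀ i, Field (C i)] [∀ i, NumberField (C i)] [∀ i, Algebra F (C i)]
    (π : ∀ i, ↥(Algebra.adjoin L ({γ} : Set (Matrix (Fin N) (Fin N) L))) →ₐ[F] C i) (hπ : ∀ i, Function.Surjective (π i))
    (hker : ∀ i b, π i b = 0 ↔ b ∈ (e i).1.asIdeal)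
    (τC : ∀ i, C i ≃ₐ[F] C i) (hτπ : ∀ i b, π i (τ b) = τC i (π i b))
    [∀ i, IsGalois (IntermediateField.fixedField (Subgroup.zpowers (τC i))) (C i)]
    (W : ∀ i, (AdeleRing (𝓞 ↥(IntermediateField.fixedField (Subgroup.zpowers (τC i)))) ↥(IntermediateField.fixedField (Subgroup.zpowers (τC i))))ˣ)
    (hW : ∀ i, AdeleRing.ideleBaseChange (↥(IntermediateField.fixedField (Subgroup.zpowers (τC i)))) (C i) (W i) =
      Units.map ((adeleRingTensorAlgEquiv F (C i)).toAlgHom.comp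
        (Algebra.TensorProduct.map (AlgHom.id (AdeleRing (𝓞 F) F) (AdeleRing (𝓞 F) F)) (π i))).toRingHom.toMonoidHom X) :
    ∃ Y : (AdeleRing (𝓞 L) L)ˣ,
      ∏ i, AdelicBaseChange.ideleRelNorm F ↥(IntermediateField.fixedField (Subgroup.zpowers (τC i))) (W i) = AdelicBaseChange.ideleRelNorm F L Y := by
  classical
  -- `B = L[γ]` is a finite `L`-algebra: finitely many maximal ideals
  haveI : IsArtinianRing ↥(Algebra.adjoin L ({γ} : Set (Matrix (Fin N) (Fin N) L))) := IsArtinianRing.of_finite L _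
  haveI : Fintype (MaximalSpectrum ↥(Algebra.adjoin L ({γ} : Set (Matrix (Fin N) (Fin N) L)))) := Fintype.ofFinite _
  -- (T0) transfers at every factor
  have hT := fun I : MaximalSpectrum ↥(Algebra.adjoin L ({γ} : Set (Matrix (Fin N) (Fin N) L))) =>
    exists_ringEquiv_apply_tmul F L (↥(Algebra.adjoin L ({γ} : Set (Matrix (Fin N) (Fin N) L))) ⧸ I.asIdeal)
  choose θ hθ using hT
  -- (N1) `det x_g = ∏_𝔪 N(θ_𝔪 ((1 ⊗ π_𝔪) X))`
  have hN1 := det_eq_prod_norm_transfer hreg Ψ hΨ θ hθ (X : AdeleRing (𝓞 F) F ⊗[F] ↥(Algebra.adjoin L ({γ} : Set (Matrix (Fin N) (Fin N) L))))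
  -- (P) orbit split of the non-stable pairs
  obtain ⟨y, hy⟩ := exists_prod_norm_transfer_eq_prod_mul_mul_apply σ σA hσA τ hτ hτσ hσ θ hθ
    (X : AdeleRing (𝓞 F) F ⊗[F] ↥(Algebra.adjoin L ({γ} : Set (Matrix (Fin N) (Fin N) L)))) hX e
  -- (S) the stable factors
  have hS : ∀ i, Algebra.norm (AdeleRing (𝓞 L) L) (θ (e i).1 (Algebra.TensorProduct.map
      (AlgHom.id (AdeleRing (𝓞 F) F) (AdeleRing (𝓞 F) F)) (Ideal.Quotient.mkₐ F (e i).1.asIdeal) ↑X)) =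
      NumberField.AdeleRing.baseChange F L
        (((AdelicBaseChange.ideleRelNorm F ↥(IntermediateField.fixedField (Subgroup.zpowers (τC i))) (W i) :
          (AdeleRing (𝓞 F) F)ˣ) : AdeleRing (𝓞 F) F)) := fun i =>
    norm_transfer_mk_eq_baseChange_ideleRelNorm σ hσ1 τ hτ hτσ X (e i).1 (π i) (hπ i) (hker i) (τC i) (hτπ i) (W i) (hW i)
      (θ (e i).1) (hθ (e i).1)
  -- assembly: `σ_𝔸 D · D = con(∏ N W_i) · (y · σ_𝔸 y)`
  have h1 : ((∏ i, AdelicBaseChange.ideleRelNorm F ↥(IntermediateField.fixedField (Subgroup.zpowers (τC i))) (W i) :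
      (AdeleRing (𝓞 F) F)ˣ) : AdeleRing (𝓞 F) F) =
      ∏ i, ((AdelicBaseChange.ideleRelNorm F ↥(IntermediateField.fixedField (Subgroup.zpowers (τC i))) (W i) :
        (AdeleRing (𝓞 F) F)ˣ) : AdeleRing (𝓞 F) F) := Units.coe_prod _ _
  have h2 : NumberField.AdeleRing.baseChange F L
      (∏ i, ((AdelicBaseChange.ideleRelNorm F ↥(IntermediateField.fixedField (Subgroup.zpowers (τC i))) (W i) :
        (AdeleRing (𝓞 F) F)ˣ) : AdeleRing (𝓞 F) F)) =
      ∏ i, NumberField.AdeleRing.baseChange F L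
        (((AdelicBaseChange.ideleRelNorm F ↥(IntermediateField.fixedField (Subgroup.zpowers (τC i))) (W i) :
          (AdeleRing (𝓞 F) F)ˣ) : AdeleRing (𝓞 F) F)) := map_prod _ _ _
  have h3 : NumberField.AdeleRing.baseChange F L
      ((∏ i, AdelicBaseChange.ideleRelNorm F ↥(IntermediateField.fixedField (Subgroup.zpowers (τC i))) (W i) :
        (AdeleRing (𝓞 F) F)ˣ) : AdeleRing (𝓞 F) F) =
      ∏ i, Algebra.norm (AdeleRing (𝓞 L) L) (θ (e i).1 (Algebra.TensorProduct.map
        (AlgHom.id (AdeleRing (𝓞 F) F) (AdeleRing (𝓞 F) F)) (Ideal.Quotient.mkₐ F (e i).1.asIdeal) ↑X)) :=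
    (congrArg (NumberField.AdeleRing.baseChange F L) h1).trans (h2.trans (Finset.prod_congr rfl fun i _ => (hS i).symm))
  have hmain : σA D * D = NumberField.AdeleRing.baseChange F L
      ((∏ i, AdelicBaseChange.ideleRelNorm F ↥(IntermediateField.fixedField (Subgroup.zpowers (τC i))) (W i) :
        (AdeleRing (𝓞 F) F)ˣ) : AdeleRing (𝓞 F) F) * (y * σA y) :=
    hD.symm.trans (hN1.trans (hy.trans (congrArg (· * (y * σA y)) h3.symm)))
  -- units: `det x_g` is a unit
  have hdet : IsUnit (σA D * D) := by
    rw [← hD]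
    exact (Matrix.isUnit_iff_isUnit_det _).mp (X.isUnit.map Ψ)
  obtain ⟨Y, hY⟩ := exists_units_apply_mul_eq σA hdet hmain
  exact ⟨Y, eq_ideleRelNorm_of_baseChange_eq_apply_mul σ hσ1 σA hσA
    (∏ i, AdelicBaseChange.ideleRelNorm F ↥(IntermediateField.fixedField (Subgroup.zpowers (τC i))) (W i)) Y hY.symm⟩

end Head

end Literature.NumberTheory.GaloisRepresentations

end
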